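/-
Copyright (c) 2026 the pub-hodgecm-mathlib formalisation cell (harness21).  Prover seat hodgecm-mathlib-LH4-p04 (g2), req620 Track A «(D-RAM) FOUR-FRAME» squad
(MS ROAD A, STAGE B brick B3₂ «TYPE-2 STRATA TABLE» — part 7: THE TYPE-2 SHAPE LIST in axis currency (B10₂ skeleton stub `stub_B3_shapes`)).  2026-09-04.
-/
import Summits.HodgeConjecture.HodgeConjecture.Theorems.F0P3cDyRamDiagonalDualisableStrataTypeTwoSieve   -- ★ part 6b (this seat): `typeTwo_sieve`
import Summits.HodgeConjecture.HodgeConjecture.Theorems.F0P3cDyRamDiagonalTypeTwoExclColumnOne        -- ★ p856333 (this seat): X2, X8, X10, X11 kills; brings ★ X1 (`not_typeTwoPolarisable_X1`)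
import Summits.HodgeConjecture.HodgeConjecture.Theorems.F0P3cDyRamDiagonalTypeTwoExclX3467            -- ★ p856158 (F0P3a-p01 (g31)): X3, X4, X6, X7 kills
import Summits.HodgeConjecture.HodgeConjecture.Theorems.F0P3cDyRamDiagonalTypeTwoExclX59              -- ★ p856284 (F0P3a-p01 (g31)): X5, X9 kills
import Summits.HodgeConjecture.HodgeConjecture.Theorems.F0P3cDyRamDiagonalHNFAxisOfExponents         -- ★ p856334 (this seat): `hasAxis_latt_hnf_of_exponents(_zero)`; brings ★ part 4 (T-lemmas, `hasAxis_of_three`), ★ part 3 (`hasAxis_unique`), ★ StrataDefs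
import Summits.HodgeConjecture.HodgeConjecture.Theorems.F0P3cDyRamDiagonalStableLatticeHNFExists      -- ★ p855304: `exists_latt_eq_latt_hnf`
import HarnessLib

/-!
# Crux `H413`, line LH4 «(D-RAM) FOUR-FRAME» road — unit U3_Laws (iii), MS ROAD A, STAGE B brick B3₂ (part 7): THE TYPE-2 SHAPE LIST — the axis vector of a normalised `T`-stable
# lattice that is a type-2 vertex for some `σ`-fixed diagonal form is `(0,s,s)∕(s,0,s)∕(s,s,0)` (`s` odd), `(r, r+s, r+s)` and rotations (`r` odd, `s ≥ 2` even), or `(r,r,r)` (`r` odd)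

Cell `hodgecm-mathlib` (D-0151), FLOOR 0, crux item H413 = `stmt-HodgeConjecture-24833`, route of record `HCCMUnconditional`; squad F0∕P3c∕LH4 (req618∕req620); registered stub served:
`F0P3cDyRamFourFrameU3.stub_U3_stableModelSum` (MS).  THEOREMS ONLY (no `def`, no instance, no notation, no `sorry`, default heartbeats); lane
`--supports stmt-HodgeConjecture-24833 --as helper` (count-neutral).  This is the B10₂ skeleton stub `stub_B3_shapes` (LH4-p10 (g2) `B10-StableCountTypeTwo.SKELETON.v1` 08e5e6e2)
in the currency of ★ `F0P3cDyRamDiagonalStrataDefs` ED. 2 (`HasAxis`, `IsTypeTwoPolarisable`): the type-2 twin of ★ part 4 `hasAxis_shapes`.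

THE MATHEMATICS (this seat's census `CENSUS-B3type2.v1`; LH4-p10 MEMO v2.1 §T2.1).  A normalised `latt g ⊆ 𝒪³` has an HNF model `V = (1 0 0; x ϖ^b 0; y z ϖ^c)` (★ `exists_latt_eq_latt_hnf`);
if it is type-2 polarisable, ★ part 6b `typeTwo_sieve` puts `(b, c, x, y, z)` in one of ten genuine strata or one of eleven residual families; the residual families are not type-2
polarisable (★ X1 and X2∕X8∕X10∕X11 of this seat, ★ X3∕X4∕X6∕X7 and X5∕X9 of F0P3a-p01 (g31) — each a one- or two-entry obstruction in the Gram ∕ dual-Gram matrix), and on each genuine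
stratum the axis vector is read off ★ `hasAxis_latt_hnf_of_exponents(_zero)` (glued∕hanging strata: `(b + (c ∸ w), b + (c ∸ m), c)`) or ★ part 4's T-lemmas: T₃ `(s,s,0)`, T₁ `(0,s,s)`,
T₂ `(s,0,s)` with `s = b` or `c` ODD; G₁(1, c−1) `(1, c, c)`, H(1) `(1,1,1)`, G₂(1, c−1) `(c, 1, c)`; G₁ `(2b+1, c, c)`, H `(c,c,c)` with `c = 2b+1`, G₂ `(c, 2b+1, c)`, G₃ `(b+m+1, b+m+1, 2m+1)`
— i.e. `(r, r+s, r+s)` up to rotation with `r` odd, `s` even, or `(r,r,r)` with `r` odd; uniqueness of the axis vector (★ part 3 `hasAxis_unique`) transfers them to the given `a`.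

WHAT IS PROVED.  HEAD `hasAxis_shapes_typeTwo` (= `stub_B3_shapes` of B10₂: hypotheses `hD`, `hM : M ∈ normalisedStableLattices T`, `hpol : IsTypeTwoPolarisable σ ϖ M`,
`ha : HasAxis ϖ M a`; the conclusion is the skeleton's three-way disjunction VERBATIM).
HONEST LABEL.  Count-neutral (`--supports`); nothing printed is asserted; (MS) stays a PROVER TARGET (empirical census law — MEMO v2∕v2.1 is its paper proof, oracle-checked);
`HC_CM` is proved only modulo the 7 printed citations (2 remaining named inputs: hLiu418 = `stmt-HodgeConjecture-24832`, h413 = `stmt-HodgeConjecture-24833`) until rung 0 closes.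

## References
* [Jacobowitz1962] R. Jacobowitz, *Hermitian forms over local fields*, Amer. J. Math. 84 (1962), §7–§8 (`𝔭`-modular lattices).
* [Kottwitz1986BaseChangeUnits] R. E. Kottwitz, *Base change for unit elements of Hecke algebras*, Compositio Math. 60 (1986), §1 pp. 240–241 (fixed lattices counted by position).
* [Serre1980Trees] J.-P. Serre, *Trees*, Springer (1980), Ch. II §1.1 (Hermite normal forms, coordinate axes).
* [BruhatTits1972] F. Bruhat, J. Tits, *Groupes réductifs sur un corps local I*, Publ. Math. IHÉS 41 (1972), §10 (apartments: distance to the splitting sub-buildings).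
-/

set_option autoImplicit false

noncomputable section

namespace Summit.HodgeConjecture.HodgeConjecture.Cruxes.H413.F0P3cDyRamDiagonalStrataShapesTypeTwo

open Matrix
open Literature.NumberTheory.Automorphic Literature.NumberTheory.Automorphic.HermitianLattice
open Literature.NumberTheory.Automorphic.UnitaryLatticeTree Literature.NumberTheory.Automorphic.UnitaryThreeFourFrame
open Summit.HodgeConjecture.HodgeConjecture.Cruxes.H413.F0P3cDyRamDiagonalTorusDefs
open Summit.HodgeConjecture.HodgeConjecture.Cruxes.H413.F0P3cDyRamDiagonalStrataDefs
open Summit.HodgeConjecture.HodgeConjecture.Cruxes.H413.F0P3cDyRamDiagonalStableLatticeHNF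
open Summit.HodgeConjecture.HodgeConjecture.Cruxes.H413.F0P3cDyRamDiagonalStableLatticeHNFExists
open Summit.HodgeConjecture.HodgeConjecture.Cruxes.H413.F0P3cDyRamDiagonalStrataAxis
open Summit.HodgeConjecture.HodgeConjecture.Cruxes.H413.F0P3cDyRamDiagonalStrataShapes
open Summit.HodgeConjecture.HodgeConjecture.Cruxes.H413.F0P3cDyRamDiagonalHNFAxisOfExponents
open Summit.HodgeConjecture.HodgeConjecture.Cruxes.H413.F0P3cDyRamDiagonalDualisableStrataTypeTwoSieve
open Summit.HodgeConjecture.HodgeConjecture.Cruxes.H413.F0P3cDyRamDiagonalTypeTwoExclX1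
open Summit.HodgeConjecture.HodgeConjecture.Cruxes.H413.F0P3cDyRamDiagonalTypeTwoExclColumnOne
open Summit.HodgeConjecture.HodgeConjecture.Cruxes.H413.F0P3cDyRamDiagonalTypeTwoExclX3467
open Summit.HodgeConjecture.HodgeConjecture.Cruxes.H413.F0P3cDyRamDiagonalTypeTwoExclX59
open scoped Valued WithZero Matrix MatrixGroups

/-- **B3₂-γ · THE TYPE-2 SHAPE LIST** (B10₂ skeleton `stub_B3_shapes`).  Under the ramified quadratic datum: if `M ∈ 𝓛₀(T)` (a normalised `T`-stable lattice — `T` arbitrary) is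
TYPE-2 POLARISABLE (`IsTypeTwoPolarisable σ ϖ M`: a type-2 vertex for some `σ`-fixed non-degenerate diagonal form) and has axis vector `a`, then `a ∈ {(0,s,s), (s,0,s), (s,s,0)}` with
`s` ODD, or `a ∈ {(2ρ+1, 2ρ+1+s, 2ρ+1+s), (2ρ+1+s, 2ρ+1, 2ρ+1+s), (2ρ+1+s, 2ρ+1+s, 2ρ+1)}` with `s ≥ 2` even, or `a = (2ρ+1, 2ρ+1, 2ρ+1)` — HNF model, ★ `typeTwo_sieve`, the eleven
★ exclusions, the stratum's axis vector, ★ `hasAxis_unique`. [cite: Jacobowitz1962, §7–§8] [cite: Kottwitz1986BaseChangeUnits, §1 pp. 240–241] [cite: Serre1980Trees, II §1.1]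
[cite: BruhatTits1972, §10] -/
theorem hasAxis_shapes_typeTwo {K : Type} [Field K] [Valued K ℤᵐ⁰] {σ : K →+* K} {ϖ : K} {d t : ℕ} {T : GL (Fin 3) K}
    (hD : IsRamifiedQuadraticDatum σ ϖ d t) {M : Submodule 𝒪[K] (Fin 3 → K)} {a : Fin 3 → ℕ}
    (hM : M ∈ normalisedStableLattices T) (hpol : IsTypeTwoPolarisable σ ϖ M) (ha : HasAxis ϖ M a) :
    (∃ s, ¬ 2 ∣ s ∧ (a = ![0, s, s] ∨ a = ![s, 0, s] ∨ a = ![s, s, 0])) ∨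
    (∃ ρ s, 2 ∣ s ∧ 2 ≤ s ∧ (a = ![2 * ρ + 1, 2 * ρ + 1 + s, 2 * ρ + 1 + s] ∨ a = ![2 * ρ + 1 + s, 2 * ρ + 1, 2 * ρ + 1 + s] ∨
      a = ![2 * ρ + 1 + s, 2 * ρ + 1 + s, 2 * ρ + 1])) ∨
    (∃ ρ, a = ![2 * ρ + 1, 2 * ρ + 1, 2 * ρ + 1]) := by
  obtain ⟨-, hvσ, hϖ, hfix, -⟩ := hD
  obtain ⟨⟨g, rfl⟩, -, hnorm⟩ := hM
  have hq : ∀ n : ℕ, Valued.v (ϖ ^ n) = WithZero.exp (-(n : ℤ)) := fun n => by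
    rw [map_pow, hϖ, ← WithZero.exp_nsmul]; congr 1; simp
  have hq1 : ∀ n : ℕ, Valued.v (ϖ ^ n) ≤ 1 := fun n => by rw [hq, ← WithZero.exp_zero, WithZero.exp_le_exp]; omega
  have hq_eq_one : ∀ n : ℕ, Valued.v (ϖ ^ n) = 1 → n = 0 := fun n h => by
    rw [hq, ← WithZero.exp_zero, WithZero.exp_inj] at h; omega
  -- the HNF model of the normalised lattice `latt g ⊆ 𝒪³`
  have hle : latt (g : Matrix (Fin 3) (Fin 3) K) ≤ stdLattice K 3 := fun w hw => mem_stdLattice.2 fun i => (hnorm i).1 w hw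
  obtain ⟨b, c, x, y, z, hx, hy, hz, hV⟩ := exists_latt_eq_latt_hnf hϖ g hle (hnorm 0).2
  rw [hV] at hnorm hpol ha
  rw [isTypeTwoPolarisable_iff] at hpol
  have hN := (normalised_latt_hnf_iff hx hy hz (hq1 b) (hq1 c)).1 hnorm
  have hxb : 1 ≤ b → Valued.v x = 1 := fun hb => hN.1.resolve_left fun h => by have := hq_eq_one b h; omega
  -- target rewriting helper: `a` equals the computed axis vector
  rcases typeTwo_sieve hvσ hfix hϖ b c hx hy hz hnorm hpol with
    ⟨hc, hb⟩ | ⟨hb, hc, hz1, hw⟩ | ⟨hb, hc, hc3, hz1, hw⟩ | ⟨hb, hc, hz1, hw⟩ | ⟨hb, hc, hzc, hy1⟩ | ⟨hb, hc, hc3, hzm, hy1⟩ |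
    ⟨hb1, hc, hcb, hzm, hy1, hw⟩ | ⟨hb1, hc, hzm, hy1, hw⟩ | ⟨hb1, hc, hcb, hzm, hy1⟩ | ⟨m, hmb, hc, hp, hzm, hy1⟩ |
    hX | hX | hX | hX | hX | hX | hX | hX | hX | hX | hX
  · -- T₃: `c = 0`, `b` odd ↦ `(b, b, 0)`
    subst c
    exact Or.inl ⟨b, by omega, Or.inr (Or.inr (hasAxis_unique hϖ ha (hasAxis_latt_hnf_T3 hϖ b (hxb (by omega)) hy hz)))⟩
  · -- T₁: `b = 0`, `|z| = 1`, `|y − xz| ≤ |ϖ^c|` ↦ `(0, c, c)`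
    subst b
    rw [pow_zero, mul_one, Valuation.map_sub_swap] at hw
    exact Or.inl ⟨c, by omega, Or.inl (hasAxis_unique hϖ ha (hasAxis_latt_hnf_T1 hϖ c hx hz1 hw))⟩
  · -- G₁(1, c−1): `b = 0`, `|z| = 1`, `|xz − y| = |ϖ^(c−1)|` ↦ `(1, c, c)`
    subst b
    have hz0 : Valued.v z = Valued.v (ϖ ^ 0) := by rw [pow_zero, map_one]; exact hz1
    have hAx := hasAxis_latt_hnf_of_exponents_zero hϖ c hx hz0 hw
    refine Or.inr (Or.inl ⟨0, c - 1, by omega, by omega, Or.inl ?_⟩)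
    rw [hasAxis_unique hϖ ha hAx]; ext i; fin_cases i <;> simp <;> omega
  · -- H(1): `b = 0`, `c = 1`, `|z| = 1`, `|xz − y| = 1` ↦ `(1, 1, 1)`
    subst b; subst c
    have hz0 : Valued.v z = Valued.v (ϖ ^ 0) := by rw [pow_zero, map_one]; exact hz1
    have hw0 : Valued.v (x * z - y * ϖ ^ 0) = Valued.v (ϖ ^ 0) := by rw [hw, pow_zero, map_one]
    have hAx := hasAxis_latt_hnf_of_exponents_zero hϖ 1 hx hz0 hw0
    refine Or.inr (Or.inr ⟨0, ?_⟩)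
    rw [hasAxis_unique hϖ ha hAx]
  · -- T₂: `b = 0`, `|z| ≤ |ϖ^c|`, `|y| = 1` ↦ `(c, 0, c)`
    subst b
    exact Or.inl ⟨c, by omega, Or.inr (Or.inl (hasAxis_unique hϖ ha (hasAxis_latt_hnf_T2 hϖ (by omega) hx hzc hy1)))⟩
  · -- G₂(1, c−1): `b = 0`, `|z| = |ϖ^(c−1)|`, `|y| = 1` ↦ `(c, 1, c)`
    subst b
    have hw0 : Valued.v (x * z - y * ϖ ^ 0) = Valued.v (ϖ ^ 0) := by
      rw [pow_zero, mul_one, Valuation.map_sub_eq_of_lt_right _ ?_, hy1, map_one]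
      rw [hy1, map_mul, hzm, hq]
      calc Valued.v x * WithZero.exp (-((c - 1 : ℕ) : ℤ)) ≤ 1 * WithZero.exp (-((c - 1 : ℕ) : ℤ)) := mul_le_mul' hx le_rfl
        _ < 1 := by rw [one_mul, ← WithZero.exp_zero, WithZero.exp_lt_exp]; omega
    have hAx := hasAxis_latt_hnf_of_exponents_zero hϖ c hx hzm hw0
    refine Or.inr (Or.inl ⟨0, c - 1, by omega, by omega, Or.inr (Or.inl ?_)⟩)
    rw [hasAxis_unique hϖ ha hAx]; ext i; fin_cases i <;> simp <;> omega
  · -- G₁: `m = b ≥ 1`, `c` odd `≥ 2b+3`, `w = c − b − 1` ↦ `(2b+1, c, c)`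
    have hAx := hasAxis_latt_hnf_of_exponents hϖ b c (hxb hb1) hzm hw
    refine Or.inr (Or.inl ⟨b, c - 2 * b - 1, by omega, by omega, Or.inl ?_⟩)
    rw [hasAxis_unique hϖ ha hAx]; ext i; fin_cases i <;> simp <;> omega
  · -- H: `m = b ≥ 1`, `c = 2b+1`, `w = b` ↦ `(c, c, c)`
    have hAx := hasAxis_latt_hnf_of_exponents hϖ b c (hxb hb1) hzm hw
    refine Or.inr (Or.inr ⟨b, ?_⟩)
    rw [hasAxis_unique hϖ ha hAx]; ext i; fin_cases i <;> simp <;> omega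
  · -- G₂: `c` odd `≥ 2b+3`, `m = c − b − 1`, `|y| = 1` ↦ `(c, 2b+1, c)` (`w = b`)
    have hx1 := hxb hb1
    have hw : Valued.v (x * z - y * ϖ ^ b) = Valued.v (ϖ ^ b) := by
      rw [Valuation.map_sub_eq_of_lt_right _ ?_, map_mul, hy1, one_mul]
      rw [map_mul, hx1, one_mul, hzm, hq, map_mul, hy1, one_mul, hq, WithZero.exp_lt_exp]; omega
    have hAx := hasAxis_latt_hnf_of_exponents hϖ b c hx1 hzm hw
    refine Or.inr (Or.inl ⟨b, c - 2 * b - 1, by omega, by omega, Or.inr (Or.inl ?_)⟩)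
    rw [hasAxis_unique hϖ ha hAx]; ext i; fin_cases i <;> simp <;> omega
  · -- G₃: `m < b`, `c = 2m+1`, `b + m` even ↦ `(b+m+1, b+m+1, 2m+1)` (`w = m`)
    have hx1 := hxb (by omega)
    have hw : Valued.v (x * z - y * ϖ ^ b) = Valued.v (ϖ ^ m) := by
      rw [Valuation.map_sub_eq_of_lt_left _ ?_, map_mul, hx1, one_mul, hzm]
      rw [map_mul, map_mul, hx1, one_mul, hzm, hq, hq]
      calc Valued.v y * WithZero.exp (-(b : ℤ)) ≤ 1 * WithZero.exp (-(b : ℤ)) := mul_le_mul' hy le_rfl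
        _ < WithZero.exp (-(m : ℤ)) := by rw [one_mul, WithZero.exp_lt_exp]; omega
    have hAx := hasAxis_latt_hnf_of_exponents hϖ b c hx1 hzm hw
    refine Or.inr (Or.inl ⟨m, b - m, by omega, by omega, Or.inr (Or.inr ?_)⟩)
    rw [hasAxis_unique hϖ ha hAx]; ext i; fin_cases i <;> simp <;> omega
  -- the eleven residual families are not type-2 polarisable
  · obtain ⟨hb2, hbe, hc, hzc, hy1, hwc⟩ := hX
    exact (not_typeTwoPolarisable_X1 hvσ hfix hϖ hx hy hz hnorm hb2 hbe hc hzc hy1 hwc hpol).elim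
  · obtain ⟨hb, hce, hcb, hzc, -, hw⟩ := hX
    exact (not_typeTwoPolarisable_X2 hvσ hfix hϖ hx hy hz hnorm hb hce hcb hzc hw hpol).elim
  · exact (typeTwo_exclX3 hvσ hfix hϖ b c hx hy hz hnorm hpol hX).elim
  · exact (typeTwo_exclX4 hvσ hfix hϖ b c hx hy hz hnorm hpol hX).elim
  · exact (typeTwo_exclX5 hvσ hfix hϖ b c hx hy hz hnorm hpol hX).elim
  · exact (typeTwo_exclX6 hvσ hfix hϖ b c hx hy hz hnorm hpol hX).elim
  · exact (typeTwo_exclX7 hvσ hfix hϖ b c hx hy hz hnorm hpol hX).elim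
  · obtain ⟨m, hm3, hmb, hc, hp, hzm, hy1⟩ := hX
    exact (not_typeTwoPolarisable_X8 hvσ hfix hϖ hx hy hz hnorm hm3 hmb hc hp hzm hy1 hpol).elim
  · exact (typeTwo_exclX9 hvσ hfix hϖ b c hx hy hz hnorm hpol hX).elim
  · obtain ⟨hb1, hce, hbc, hzb, hy1, h⟩ := hX
    rcases h with ⟨hb, hwc⟩ | ⟨hb2, hcb, hw⟩
    · exact (not_typeTwoPolarisable_X10a_X11a hvσ hfix hϖ hx hy hz hnorm (Or.inl hb) hce (by omega) hzb hwc hpol).elim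
    · exact (not_typeTwoPolarisable_X10b_X11b hvσ hfix hϖ hx hy hz hnorm hce hzb hy1 (k := 1) (Or.inl rfl) (by omega) (by omega) hw hpol).elim
  · obtain ⟨hb2, hce, hbc, hzb, hy1, h⟩ := hX
    rcases h with ⟨hb, hwc⟩ | ⟨hb3, hcb, hw⟩
    · exact (not_typeTwoPolarisable_X10a_X11a hvσ hfix hϖ hx hy hz hnorm (Or.inr hb) hce (by omega) hzb hwc hpol).elim
    · exact (not_typeTwoPolarisable_X10b_X11b hvσ hfix hϖ hx hy hz hnorm hce hzb hy1 (k := 2) (Or.inr rfl) (by omega) (by omega) hw hpol).elim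

end Summit.HodgeConjecture.HodgeConjecture.Cruxes.H413.F0P3cDyRamDiagonalStrataShapesTypeTwo

end
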